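import Summits.Ventures.PercRepro.Night2LocalD3ThreeTwoC

/-!
# PercRepro — the cell `(a, k) = (3, 2)` at `|E ∖ G| = 3`, `q = 4`: the traces of the candidates on `G ∖ S` (night-2, gen 13)

Sequel of `Night2LocalD3ThreeTwoC.lean` (the candidates `cand w = insert w (coloops S)`, `w ∈ T` = the three non-coloops of the
far set `S`, `coloops S = K ∪ {x}`).  Write `P = G ∖ S`.  The incidence count behind the tight case of
`proofs/NIGHT-2-dq3.md` §5.5:

* the traces `P ∩ cl(cand w)` are pairwise disjoint (`not_mem_clF_cand_of_mem_clF_cand`: two candidates lie in the independent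
  `S ∖ u'`, the intersection of the closures is `cl(K ∪ {x})`, of rank `3`, while `K ∪ {x, p}` has rank `4`) and avoid `cl(S ∖ x)`
  (`not_mem_clF_erase_of_mem_clF_cand`: `cl(S ∖ x) ⊆ cl(K ∪ {w, u})`, both sets inside `S ∖ u'`, intersection `cl(K ∪ {w})`);
* hence `Σ_w |P ∩ cl(cand w)| ≤ |P ∖ cl(S ∖ x)|` (`sum_card_trace_le`) and `≤ |P|` (`sum_card_trace_le_card`);
* `|G ∖ cl(cand w)| + |P ∩ cl(cand w)| = 2 + |P|` (`card_sdiff_clF_cand`), `|G ∖ cl(S ∖ x)| = 1 + |P ∖ cl(S ∖ x)|`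
  (`card_sdiff_clF_erase`), `|P| ≥ 2` when `S ∖ x ∈ U_G` (`two_le_card_sdiff_of_erase_mem_Uq`), and `|G ∖ cl(S ∖ x)| ≥ 2`
  (`two_le_card_sdiff_clF_erase`: otherwise `cl(S ∖ x) = G ∖ x` and `x` would be a coloop of `M|G`).
-/

open scoped Matroid

namespace PercRepro.Shadow

open Finset PerFlat ThmH

variable {α : Type*} [DecidableEq α] {M : Matroid α} [M.Finite]

section ThreeTwoTrace

variable {G S : Finset α}

/-- **The traces of two candidates on `G ∖ S` are disjoint**: `cand w` and `cand w'` lie in the independent set `S ∖ u'`,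
so a common point of the closures lies in `cl(cand w ∩ cand w') = cl(coloops S) = cl(K ∪ {x})`, impossible by the rank lemma. -/
theorem not_mem_clF_cand_of_mem_clF_cand (hs : ∀ e ∈ gr M, ∀ f ∈ gr M, e ≠ f → rkN M {e, f} = 2)
    (hG : G ∈ flatsQ M (4 + 1)) (hk : kColoops M G = 2) (hS : S ∈ shadowAt M (4 + 2) 4 (Uq M (4 + 2) 4) G)
    (hS6 : S.card = 6) (hT : (nonColoops M S).card = 3) {x : α}
    (hxK : x ∉ G.filter (fun y => y ∉ clF M (G.erase y)))
    (hcol : coloops M S = insert x (G.filter (fun y => y ∉ clF M (G.erase y)))) {w w' : α}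
    (hw : w ∈ nonColoops M S) (hw' : w' ∈ nonColoops M S) (hne : w ≠ w') {p : α} (hpG : p ∈ G) (hpS : p ∉ S)
    (hp : p ∈ clF M (insert w (coloops M S))) : p ∉ clF M (insert w' (coloops M S)) := by
  intro hp'
  obtain ⟨u', hu'T, hu'w, hu'w', hSu'⟩ := exists_third_nonColoop hT hw hw' hne
  have hI : M.Indep ((S.erase u' : Finset α) : Set α) := indep_erase_of_mem_nonColoops hG hS hS6 hu'T
  have h1 : insert w (coloops M S) ⊆ S.erase u' := insert_coloops_subset_erase hw hu'T (Ne.symm hu'w)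
  have h2 : insert w' (coloops M S) ⊆ S.erase u' := insert_coloops_subset_erase hw' hu'T (Ne.symm hu'w')
  have hint : insert w (coloops M S) ∩ insert w' (coloops M S) = coloops M S := by
    ext e
    simp only [Finset.mem_inter, Finset.mem_insert]
    constructor
    · rintro ⟨h | h, h' | h'⟩
      · exact absurd (h.symm.trans h') hne
      · exact h'
      · exact h
      · exact h
    · intro h; exact ⟨Or.inr h, Or.inr h⟩
  have hpcl : p ∈ clF M (coloops M S) := by
    rw [← hint]; exact mem_clF_inter_of_indep hI h1 h2 hp hp'
  rw [hcol] at hpcl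
  have hxS : x ∈ S := coloops_subset_self S (by rw [hcol]; exact Finset.mem_insert_self x _)
  have hxG : x ∈ G := subset_of_mem_shadowAt hS hxS
  have hpK : p ∉ G.filter (fun y => y ∉ clF M (G.erase y)) :=
    fun h => hpS (coloops_subset_self S (coloopsG_subset_coloops hS h))
  exact not_mem_clF_insert_K_of_ne hs hG hk hxG hxK hpG hpK (fun h => hpS (h ▸ hxS)) hpcl

/-- The non-coloops of a far set with three coloops have rank `2` (they form a line). -/
theorem rkN_nonColoops_eq_two (hG : G ∈ flatsQ M (4 + 1)) (hS : S ∈ shadowAt M (4 + 2) 4 (Uq M (4 + 2) 4) G)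
    (ha : (coloops M S).card = 3) : rkN M (nonColoops M S) = 2 := by
  have hSg : S ⊆ gr M := (subset_of_mem_shadowAt hS).trans (mem_flatsQ.1 hG).1
  have h := rkN_nonColoops_add hSg
  rw [ha, rkN_eq_of_mem_shadowAt hS] at h
  omega

open scoped Classical in
/-- **The trace of a candidate avoids `cl(S ∖ x)`**: `cl(S ∖ x) ⊆ cl(K ∪ {w, u})` (`T` has rank `2`), both sets lie in the
independent `S ∖ u'`, and the intersection `cl(K ∪ {w})` contains no point of `G ∖ S` by the rank lemma. -/
theorem not_mem_clF_erase_of_mem_clF_cand (hs : ∀ e ∈ gr M, ∀ f ∈ gr M, e ≠ f → rkN M {e, f} = 2)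
    (hG : G ∈ flatsQ M (4 + 1)) (hk : kColoops M G = 2) (hS : S ∈ shadowAt M (4 + 2) 4 (Uq M (4 + 2) 4) G)
    (hS6 : S.card = 6) (hT : (nonColoops M S).card = 3) {x : α}
    (hxK : x ∉ G.filter (fun y => y ∉ clF M (G.erase y)))
    (hcol : coloops M S = insert x (G.filter (fun y => y ∉ clF M (G.erase y)))) {w : α}
    (hw : w ∈ nonColoops M S) {p : α} (hpG : p ∈ G) (hpS : p ∉ S)
    (hp : p ∈ clF M (insert w (coloops M S))) : p ∉ clF M (S.erase x) := by
  intro hpx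
  set K := G.filter (fun y => y ∉ clF M (G.erase y)) with hKdef
  have hGg : G ⊆ gr M := (mem_flatsQ.1 hG).1
  have hSG : S ⊆ G := subset_of_mem_shadowAt hS
  have hSg : S ⊆ gr M := hSG.trans hGg
  have hxcol : x ∈ coloops M S := by rw [hcol]; exact Finset.mem_insert_self x _
  have hxS : x ∈ S := coloops_subset_self S hxcol
  have hxG : x ∈ G := hSG hxS
  -- a second non-coloop `u`
  have hex : ∃ u ∈ nonColoops M S, u ≠ w := by
    by_contra hall
    push Not at hall
    have : nonColoops M S ⊆ {w} := fun e he => Finset.mem_singleton.2 (hall e he)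
    have := Finset.card_le_card this
    rw [hT, Finset.card_singleton] at this
    omega
  obtain ⟨u, hu, huw⟩ := hex
  obtain ⟨u', hu'T, hu'w, hu'u, hSu'⟩ := exists_third_nonColoop hT hw hu (Ne.symm huw)
  have hI : M.Indep ((S.erase u' : Finset α) : Set α) := indep_erase_of_mem_nonColoops hG hS hS6 hu'T
  -- `Y = K ∪ {w, u}` spans `S ∖ x`
  set Y := insert u (insert w K) with hYdef
  have hxw : x ≠ w := fun h => (mem_nonColoops.1 hw).2 (h ▸ hxcol)
  have hxu : x ≠ u := fun h => (mem_nonColoops.1 hu).2 (h ▸ hxcol)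
  have hYsub : Y ⊆ S.erase u' := by
    intro e he
    rw [hYdef, Finset.mem_insert, Finset.mem_insert] at he
    rw [Finset.mem_erase]
    rcases he with rfl | rfl | heK
    · exact ⟨Ne.symm hu'u, (mem_nonColoops.1 hu).1⟩
    · exact ⟨Ne.symm hu'w, (mem_nonColoops.1 hw).1⟩
    · have : e ∈ coloops M S := by rw [hcol]; exact Finset.mem_insert_of_mem heK
      refine ⟨?_, coloops_subset_self S this⟩
      rintro rfl
      exact (mem_nonColoops.1 hu'T).2 this
  have hYx : Y ⊆ S.erase x := by
    intro e he
    have heS : e ∈ S := (Finset.mem_erase.1 (hYsub he)).2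
    rw [Finset.mem_erase]
    refine ⟨?_, heS⟩
    rintro rfl
    rw [hYdef, Finset.mem_insert, Finset.mem_insert] at he
    rcases he with h | h | h
    · exact hxu h
    · exact hxw h
    · exact hxK h
  have hYI : M.Indep ((Y : Finset α) : Set α) := hI.subset (by exact_mod_cast hYsub)
  have hKc : K.card = 2 := by unfold kColoops at hk; rw [← hKdef] at hk; exact hk
  have hwK : w ∉ K := fun h => (mem_nonColoops.1 hw).2 (by rw [hcol]; exact Finset.mem_insert_of_mem h)
  have huK : u ∉ K := fun h => (mem_nonColoops.1 hu).2 (by rw [hcol]; exact Finset.mem_insert_of_mem h)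
  have hYc : Y.card = 4 := by
    rw [hYdef, Finset.card_insert_of_notMem, Finset.card_insert_of_notMem hwK, hKc]
    rw [Finset.mem_insert]
    rintro (h | h)
    · exact huw h
    · exact huK h
  have hrY : rkN M Y = 4 := by rw [rkN_eq_card_of_indep hYI, hYc]
  have hrSx : rkN M (S.erase x) = 4 := by
    have := rkN_erase_of_mem_coloops hSg hxcol
    rw [rkN_eq_of_mem_shadowAt hS] at this
    omega
  have hspan : S.erase x ⊆ clF M Y := by
    have h := subset_closure_of_rkN_eq ((Finset.erase_subset x S).trans hSg) hYx (by rw [hrY, hrSx])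
    intro e he
    rw [← Finset.mem_coe, coe_clF]
    exact h (by exact_mod_cast he)
  have hpY : p ∈ clF M Y := by
    have h1 : clF M (S.erase x) ⊆ clF M (clF M Y) := clF_mono hspan
    rw [clF_clF_self] at h1
    exact h1 hpx
  -- intersect with `cand w` inside the independent `S ∖ u'`
  have hcand : insert w (coloops M S) ⊆ S.erase u' := insert_coloops_subset_erase hw hu'T (Ne.symm hu'w)
  have hint : insert w (coloops M S) ∩ Y = insert w K := by
    ext e
    rw [hcol, hYdef]
    simp only [Finset.mem_inter, Finset.mem_insert]
    constructor
    · rintro ⟨h | h | h, h' | h' | h'⟩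
      · exact Or.inl h
      · exact Or.inl h
      · exact Or.inl h
      · exact absurd (h.symm.trans h') hxu
      · exact absurd (h.symm.trans h') hxw
      · exact absurd (h ▸ h') hxK
      · exact Or.inr h
      · exact Or.inr h
      · exact Or.inr h
    · rintro (h | h)
      · exact ⟨Or.inl h, Or.inr (Or.inl h)⟩
      · exact ⟨Or.inr (Or.inr h), Or.inr (Or.inr h)⟩
  have hpcl : p ∈ clF M (insert w K) := by
    rw [← hint]; exact mem_clF_inter_of_indep hI hcand hYsub hp hpY
  have hpK : p ∉ K := fun h => hpS (coloops_subset_self S (coloopsG_subset_coloops hS h))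
  have hwG : w ∈ G := hSG (mem_nonColoops.1 hw).1
  exact not_mem_clF_insert_K_of_ne hs hG hk hwG hwK hpG hpK (fun h => hpS (h ▸ (mem_nonColoops.1 hw).1)) hpcl

open scoped Classical in
/-- **The trace count**: `Σ_{w ∈ T} |(G ∖ S) ∩ cl(cand w)| ≤ |(G ∖ S) ∖ cl(S ∖ x)|`. -/
theorem sum_card_trace_le (hs : ∀ e ∈ gr M, ∀ f ∈ gr M, e ≠ f → rkN M {e, f} = 2)
    (hG : G ∈ flatsQ M (4 + 1)) (hk : kColoops M G = 2) (hS : S ∈ shadowAt M (4 + 2) 4 (Uq M (4 + 2) 4) G)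
    (hS6 : S.card = 6) (hT : (nonColoops M S).card = 3) {x : α}
    (hxK : x ∉ G.filter (fun y => y ∉ clF M (G.erase y)))
    (hcol : coloops M S = insert x (G.filter (fun y => y ∉ clF M (G.erase y)))) :
    ∑ w ∈ nonColoops M S, ((G \ S) ∩ clF M (insert w (coloops M S))).card ≤ ((G \ S) \ clF M (S.erase x)).card := by
  rw [← Finset.card_biUnion]
  · apply Finset.card_le_card
    intro p hp
    rw [Finset.mem_biUnion] at hp
    obtain ⟨w, hw, hp⟩ := hp
    rw [Finset.mem_inter, Finset.mem_sdiff] at hp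
    rw [Finset.mem_sdiff, Finset.mem_sdiff]
    exact ⟨hp.1, not_mem_clF_erase_of_mem_clF_cand hs hG hk hS hS6 hT hxK hcol (Finset.mem_coe.1 hw) hp.1.1 hp.1.2 hp.2⟩
  · intro w hw w' hw' hne
    show Disjoint _ _
    rw [Finset.disjoint_left]
    intro p hp hp'
    rw [Finset.mem_inter, Finset.mem_sdiff] at hp hp'
    exact not_mem_clF_cand_of_mem_clF_cand hs hG hk hS hS6 hT hxK hcol (Finset.mem_coe.1 hw) (Finset.mem_coe.1 hw')
      hne hp.1.1 hp.1.2 hp.2 hp'.2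

open scoped Classical in
/-- The traces are disjoint subsets of `G ∖ S`: `Σ_{w ∈ T} |(G ∖ S) ∩ cl(cand w)| ≤ |G ∖ S|`. -/
theorem sum_card_trace_le_card (hs : ∀ e ∈ gr M, ∀ f ∈ gr M, e ≠ f → rkN M {e, f} = 2)
    (hG : G ∈ flatsQ M (4 + 1)) (hk : kColoops M G = 2) (hS : S ∈ shadowAt M (4 + 2) 4 (Uq M (4 + 2) 4) G)
    (hS6 : S.card = 6) (hT : (nonColoops M S).card = 3) {x : α}
    (hxK : x ∉ G.filter (fun y => y ∉ clF M (G.erase y)))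
    (hcol : coloops M S = insert x (G.filter (fun y => y ∉ clF M (G.erase y)))) :
    ∑ w ∈ nonColoops M S, ((G \ S) ∩ clF M (insert w (coloops M S))).card ≤ (G \ S).card := by
  rw [← Finset.card_biUnion]
  · apply Finset.card_le_card
    intro p hp
    rw [Finset.mem_biUnion] at hp
    obtain ⟨w, -, hp⟩ := hp
    exact (Finset.mem_inter.1 hp).1
  · intro w hw w' hw' hne
    show Disjoint _ _
    rw [Finset.disjoint_left]
    intro p hp hp'
    rw [Finset.mem_inter, Finset.mem_sdiff] at hp hp'
    exact not_mem_clF_cand_of_mem_clF_cand hs hG hk hS hS6 hT hxK hcol (Finset.mem_coe.1 hw) (Finset.mem_coe.1 hw')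
      hne hp.1.1 hp.1.2 hp.2 hp'.2

/-- `|G ∖ cl(cand w)| = 2 + |G ∖ S| − |(G ∖ S) ∩ cl(cand w)|`, stated additively:
`|G ∖ cl(cand w)| + |(G ∖ S) ∩ cl(cand w)| = 2 + |G ∖ S|`. -/
theorem card_sdiff_clF_cand (hG : G ∈ flatsQ M (4 + 1)) (hS : S ∈ shadowAt M (4 + 2) 4 (Uq M (4 + 2) 4) G)
    (hS6 : S.card = 6) (hT : (nonColoops M S).card = 3) {w : α} (hw : w ∈ nonColoops M S) :
    (G \ clF M (insert w (coloops M S))).card + ((G \ S) ∩ clF M (insert w (coloops M S))).card =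
      2 + (G \ S).card := by
  have hSG : S ⊆ G := subset_of_mem_shadowAt hS
  set C := clF M (insert w (coloops M S)) with hCdef
  -- split `G ∖ C` into `S ∖ C` and `(G ∖ S) ∖ C`
  have hsplit : G \ C = (S \ C) ∪ ((G \ S) \ C) := by
    ext e
    simp only [Finset.mem_union, Finset.mem_sdiff]
    constructor
    · rintro ⟨heG, heC⟩
      by_cases heS : e ∈ S
      · exact Or.inl ⟨heS, heC⟩
      · exact Or.inr ⟨⟨heG, heS⟩, heC⟩
    · rintro (⟨heS, heC⟩ | ⟨⟨heG, -⟩, heC⟩)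
      · exact ⟨hSG heS, heC⟩
      · exact ⟨heG, heC⟩
  have hdisj : Disjoint (S \ C) ((G \ S) \ C) := by
    rw [Finset.disjoint_left]
    intro e he he'
    exact (Finset.mem_sdiff.1 (Finset.mem_sdiff.1 he').1).2 (Finset.mem_sdiff.1 he).1
  -- `S ∖ C = T ∖ w`
  have hSC : S \ C = (nonColoops M S).erase w := by
    ext e
    rw [Finset.mem_sdiff, Finset.mem_erase]
    constructor
    · rintro ⟨heS, heC⟩
      have hSg : insert w (coloops M S) ⊆ gr M :=
        (Finset.insert_subset (mem_nonColoops.1 hw).1 (coloops_subset_self S)).trans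
          (hSG.trans (mem_flatsQ.1 hG).1)
      have hnot : e ∉ insert w (coloops M S) := fun h => heC (subset_clF_of_subset_gr hSg h)
      rw [Finset.mem_insert, not_or] at hnot
      exact ⟨hnot.1, mem_nonColoops.2 ⟨heS, hnot.2⟩⟩
    · rintro ⟨hew, he⟩
      exact ⟨(mem_nonColoops.1 he).1, not_mem_clF_cand_of_ne hG hS hS6 hT hw he (Ne.symm hew)⟩
  rw [hsplit, Finset.card_union_of_disjoint hdisj, hSC, Finset.card_erase_of_mem hw, hT]
  have h2 := Finset.card_sdiff_add_card_inter (G \ S) C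
  omega

/-- `|G ∖ cl(S ∖ x)| = 1 + |(G ∖ S) ∖ cl(S ∖ x)|` for a coloop `x` of the shadow set `S`. -/
theorem card_sdiff_clF_erase (hG : G ∈ flatsQ M (4 + 1)) (hS : S ∈ shadowAt M (4 + 2) 4 (Uq M (4 + 2) 4) G)
    {x : α} (hx : x ∈ coloops M S) :
    (G \ clF M (S.erase x)).card = 1 + ((G \ S) \ clF M (S.erase x)).card := by
  have hSG : S ⊆ G := subset_of_mem_shadowAt hS
  have hSg : S ⊆ gr M := hSG.trans (mem_flatsQ.1 hG).1
  have hxS : x ∈ S := (mem_coloops.1 hx).1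
  have hxcl : x ∉ clF M (S.erase x) := (mem_coloops.1 hx).2
  have hsplit : G \ clF M (S.erase x) = insert x ((G \ S) \ clF M (S.erase x)) := by
    ext e
    simp only [Finset.mem_insert, Finset.mem_sdiff]
    constructor
    · rintro ⟨heG, hecl⟩
      by_cases hex : e = x
      · exact Or.inl hex
      · right
        refine ⟨⟨heG, fun heS => hecl ?_⟩, hecl⟩
        exact subset_clF_of_subset_gr ((Finset.erase_subset x S).trans hSg) (Finset.mem_erase.2 ⟨hex, heS⟩)
    · rintro (rfl | ⟨⟨heG, -⟩, hecl⟩)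
      · exact ⟨hSG hxS, hxcl⟩
      · exact ⟨heG, hecl⟩
  rw [hsplit, Finset.card_insert_of_notMem]
  · ring
  · intro h
    exact (Finset.mem_sdiff.1 (Finset.mem_sdiff.1 h).1).2 hxS

/-- `|G ∖ S| ≥ 2` when `S ∖ x ∈ U_G`: `E ∖ (S ∖ x) ⊆ {x} ∪ (G ∖ S) ∪ (E ∖ G)` must have rank `6`. -/
theorem two_le_card_sdiff_of_erase_mem_Uq (hd : (gr M \ G).card = 3) {x : α}
    (hxU : S.erase x ∈ Uq M (4 + 2) 4) :
    2 ≤ (G \ S).card := by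
  have hr6 : rkN M (gr M \ S.erase x) = 6 := by
    have h := (mem_Uq.1 hxU).2.2
    rw [eRk_eq_rkN] at h
    exact_mod_cast h
  have hsub : gr M \ S.erase x ⊆ insert x ((G \ S) ∪ (gr M \ G)) := by
    intro e he
    rw [Finset.mem_sdiff, Finset.mem_erase, not_and_or, not_not] at he
    rw [Finset.mem_insert, Finset.mem_union, Finset.mem_sdiff, Finset.mem_sdiff]
    rcases he.2 with rfl | heS
    · exact Or.inl rfl
    · right
      by_cases heG : e ∈ G
      · exact Or.inl ⟨heG, heS⟩
      · exact Or.inr ⟨he.1, heG⟩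
  have h1 := rkN_mono (M := M) hsub
  have h2 := rkN_le_card (M := M) (insert x ((G \ S) ∪ (gr M \ G)))
  have h3 := Finset.card_insert_le x ((G \ S) ∪ (gr M \ G))
  have h4 := Finset.card_union_le (G \ S) (gr M \ G)
  omega

/-- `|G ∖ cl(S ∖ x)| ≥ 2` for the non-`K` coloop `x` of `S`: otherwise `cl(S ∖ x) = G ∖ x` and `x` is a coloop of `M|G`. -/
theorem two_le_card_sdiff_clF_erase (hS : S ∈ shadowAt M (4 + 2) 4 (Uq M (4 + 2) 4) G)
    {x : α} (hxK : x ∉ G.filter (fun y => y ∉ clF M (G.erase y))) (hx : x ∈ coloops M S) :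
    2 ≤ (G \ clF M (S.erase x)).card := by
  have hSG : S ⊆ G := subset_of_mem_shadowAt hS
  have hxS : x ∈ S := (mem_coloops.1 hx).1
  have hxG : x ∈ G := hSG hxS
  have hxcl : x ∉ clF M (S.erase x) := (mem_coloops.1 hx).2
  by_contra hlt
  push Not at hlt
  have hsub : G.erase x ⊆ clF M (S.erase x) := by
    intro e he
    by_contra hecl
    have h1 : {x, e} ⊆ G \ clF M (S.erase x) := by
      intro f hf
      rw [Finset.mem_insert, Finset.mem_singleton] at hf
      rw [Finset.mem_sdiff]
      rcases hf with rfl | rfl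
      · exact ⟨hxG, hxcl⟩
      · exact ⟨(Finset.mem_erase.1 he).2, hecl⟩
    have h2 := Finset.card_le_card h1
    rw [Finset.card_pair (Ne.symm (Finset.mem_erase.1 he).1)] at h2
    omega
  apply hxK
  rw [Finset.mem_filter]
  refine ⟨hxG, fun h => hxcl ?_⟩
  have h1 : clF M (G.erase x) ⊆ clF M (clF M (S.erase x)) := clF_mono hsub
  rw [clF_clF_self] at h1
  exact h1 h

end ThreeTwoTrace

end PercRepro.Shadow
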